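import Summits.QuantumFields.YangMills.Theorems.IsotropyFromPowerCountingEngineFromPowerCounting

/-!
# `SoftKernelBoostCovariance`: the pointwise composition with the WEAK `45°` sandwich row, and the crux modulo its two residuals

Line `Sketch` of crux `MirrorModularBoosts.SoftKernelBoostCovariance` (stmt-QuantumFields-14999; route-QuantumFields-MirrorModularBoosts),
skeleton v3.11 (lead c6), registered stub `stub_planarInvariantOfInputsWeak` (imports: the landed p136406 composition and p138806).

The landed pointwise composition `stub_planarInvariantOfInputs` (p136406) asks the transversely filtered heat-sandwich bound Σ with ONE
POWER OF SLACK (`μ < 4`) for BOTH `e₀`-reconstructions: of `S₁` and of its `45°` pull-back.  But the chain consumes the pull-back family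
only through its UNIFORM boost vectors (`stub_asmUniformBoost`, p135459), whose exponential type never enters the sieve — the TYPED boost
vectors (`stub_asmTypedBoost`, type `max μ 0 < 4`, the input of the level growth `stub_levelGrowthHigh_of_boostType`) are built from the
`e₀`-row alone.  So the `45°` row is needed only as a POLYNOMIAL sandwich bound with an ARBITRARY exponent:

* `stub_planarInvariantOfInputsWeak` — verbatim `stub_planarInvariantOfInputs` with `∃ μ C, μ < 4 ∧ …` replaced by `∃ μ C, …` in the
  `45°` row (same proof; the discarded hypothesis is simply not asked);
* `cruxOfInputsKWeak` — the crux from Step 0 (kernel antecedent) and the SANDWICH PAIR (Σ_e₀ with `μ < 4`, Σ_45° with any `μ`);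
* `sandwichPair_of_curvatureSandwichBound` — the item `CurvatureSandwichBound` (stmt-QuantumFields-18372) implies the pair (one line);
* (the crux modulo EXACTLY its two v3.11 residuals — the regularity of `𝔖ₙ|⁰𝒮` for `n ≥ 3` (`stub_stepZeroByDegrees`, p142709) and the
  sandwich pair — is then `cruxOfInputsKWeak (stub_stepZeroByDegrees hHigh) hPair`; recorded in a separate file to keep this module's
  import cone at p136406 + p138806).

Consequence for refuters/planners: a Wilson limit violating the `45°` row of the ITEM only through its exponent (`μ ≥ 4` there) refutes
stmt-18372 as typed but NOT this line; the load-bearing content of Σ is (i) `μ < 4` in the `e₀` frame and (ii) SOME polynomial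
heat-sandwich bound in the diagonal frame.
-/

noncomputable section

namespace Summit.QuantumFields.YangMills.Theorems.SoftKernelBoostCovariance.Sketch

open scoped BigOperators SchwartzMap InnerProductSpace
open MeasureTheory Filter Topology
open Literature.MathematicalPhysics.QuantumLattice Literature.MathematicalPhysics.AQFT
  Literature.MathematicalPhysics.QuantumFieldTheory
open Summit.QuantumFields.YangMills.Theorems.NPointIsotropy.Negative (E4 NPointRegular)
open Summit.QuantumFields.YangMills.Theorems.CurvatureBoostCovariance.Negative
  (OSPackage Translations Hypercubic EightFrameRP PlanarCone PlanarInvariant Tie Gaps W1)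
open Summit.QuantumFields.YangMills.Theorems.CurvatureBoostCovariance.BoostsInheritMirrors
  (stub_orbitBandlimit stub_rayPositivity stub_doubledToInvariant stub_tensorDensity stub_paritySieve
    trigPoly_coeff_eq_zero_of_const)
open Summit.QuantumFields.YangMills.Theorems.CurvatureBoostCovariance.BoostsInheritMirrors.RayPositivity
  (pencil_eq_inner orbit_eq_inner osReconstruction_of exists_isTimeOrdered_planeRot translations_pullBack
    isSymmetric_pullBack hasLinearGrowth_pullBack isReflectionPositive_pullBack eightFrameRP_pullBack planarCone_pullBack)

/-- **PLANAR INVARIANCE OF ONE FAMILY FROM ITS INPUTS — WEAK `45°` ROW (registered stub `stub_planarInvariantOfInputsWeak`; the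
pointwise, model-blind composition of line `Sketch`, verbatim the landed `stub_planarInvariantOfInputs` p136406 EXCEPT that the sandwich
bound of the `45°` pull-back is asked with an ARBITRARY exponent `μ` — no `μ < 4`: the chain consumes the pull-back only through its
UNIFORM boost vectors, whose type is irrelevant to the sieve).**
For a one-species family `S₁` on `ℝ⁴` with the OS package, translations and proper-hypercubic invariance on `⁰𝒮`,
reflection positivity in the eight planar frames, the planar spectral cone and the soft two-point kernel triple: IF every
`𝔖ₙ|⁰𝒮` is a function (`NPointRegular S₁`, Step 0) and the transversely filtered heat-sandwich bound with exponent `μ < 4` holds for every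
`e₀`-reconstruction of `S₁` and of its `45°` pull-back (Σ), THEN `S₁` is invariant on `⁰𝒮` under every rotation of the
`(x₀,x₁)`-plane.  Proof = the landed chain: reconstructions (`osReconstruction_of`, `*_pullBack`, `PlanarSpectralCone_of`), cone
families (`stub_coneFamily`), `sandwich_mono_exponent`, uniform and typed boost vectors (`stub_asmUniformBoost`,
`stub_asmTypedBoost`), band limit and ray positivity (`stub_orbitBandlimitLocal`, `stub_rayPositivityLocal`), level growth
(`levelGrowthLow_of_kernel_pointwise`, `stub_levelGrowthHigh_of_boostType`, `stub_laurentLayers`) and the parity sieve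
(`sieve_of_stubs`). -/
theorem stub_planarInvariantOfInputsWeak :
    open Literature.MathematicalPhysics.QuantumLattice Literature.MathematicalPhysics.AQFT
      Literature.MathematicalPhysics.QuantumFieldTheory
      Summit.QuantumFields.YangMills.Theorems.CurvatureBoostCovariance.Negative
      Summit.QuantumFields.YangMills.Theorems.NPointIsotropy.Negative in
    ∀ (S₁ : SchwingerFamily E4), OSPackage S₁ → Translations S₁ → Hypercubic S₁ → EightFrameRP S₁ → PlanarCone S₁ →
      (∃ (K : E4 → ℝ) (C η : ℝ), 0 < η ∧ ContinuousOn K {x : E4 | x ≠ 0} ∧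
        (∀ x : E4, x ≠ 0 → |K x| ≤ C * (1 + ‖x‖ ^ (η - 10))) ∧
        ∀ F : SchwartzMap (Fin 2 → E4) ℂ, IsOffDiagonal F →
          MeasureTheory.Integrable (fun x : Fin 2 → E4 => (K (x 0 - x 1) : ℂ) * F x) ∧
            S₁ 2 F = ∫ x : Fin 2 → E4, (K (x 0 - x 1) : ℂ) * F x) →
      NPointRegular S₁ →
      (∀ (h : OSReconstructionNoE1 S₁.toLabelled), ∃ μ C : ℝ, μ < 4 ∧
        (∀ (u v : ℝ), 0 < u → 0 < v → u ≤ 1 → v ≤ 1 →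
           ∀ (f₁ : SchwartzMap (Fin 1 → E4) ℂ) (g hh : ℝ × ℝ → ℂ) (Mg Mh Mh' : ℝ),
             (∀ x : Fin 1 → E4, f₁ x = g (x 0 0, x 0 1) * hh (x 0 2, x 0 3)) →
             (∀ p : ℝ × ℝ, g p ≠ 0 → u ≤ p.1 ∧ p.1 ≤ 2 * u) →
             MeasureTheory.Integrable g → (∫ p, ‖g p‖) ≤ Mg →
             MeasureTheory.Integrable hh → (∫ p, ‖hh p‖) ≤ Mh → (∀ p, ‖hh p‖ ≤ Mh') →
           ∀ (n : ℕ) (W : SchwartzMap (Fin n → E4) ℂ) (hW : IsTimeOrdered W)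
             (hFW : IsTimeOrdered
               (SchwartzMap.appendTensor f₁ (translateMulti ((2 * u + v) • EuclideanSpace.single 0 1) W))),
             ‖h.fieldVec (1 + n) (fun _ => ())
                 (SchwartzMap.appendTensor f₁ (translateMulti ((2 * u + v) • EuclideanSpace.single 0 1) W)) hFW‖
               ≤ C * Mg * (Mh + Mh') * (u ^ (-μ) + v ^ (-μ)) * ‖h.fieldVec n (fun _ => ()) W hW‖)) →
      (∀ (h' : OSReconstructionNoE1 (SchwingerFamily.toLabelled
          (fun n => (S₁ n).comp (linActMulti (planeRot (0 : Fin 3) (Real.pi / 4)))))),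
        ∃ μ C : ℝ,
        (∀ (u v : ℝ), 0 < u → 0 < v → u ≤ 1 → v ≤ 1 →
           ∀ (f₁ : SchwartzMap (Fin 1 → E4) ℂ) (g hh : ℝ × ℝ → ℂ) (Mg Mh Mh' : ℝ),
             (∀ x : Fin 1 → E4, f₁ x = g (x 0 0, x 0 1) * hh (x 0 2, x 0 3)) →
             (∀ p : ℝ × ℝ, g p ≠ 0 → u ≤ p.1 ∧ p.1 ≤ 2 * u) →
             MeasureTheory.Integrable g → (∫ p, ‖g p‖) ≤ Mg →
             MeasureTheory.Integrable hh → (∫ p, ‖hh p‖) ≤ Mh → (∀ p, ‖hh p‖ ≤ Mh') →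
           ∀ (n : ℕ) (W : SchwartzMap (Fin n → E4) ℂ) (hW : IsTimeOrdered W)
             (hFW : IsTimeOrdered
               (SchwartzMap.appendTensor f₁ (translateMulti ((2 * u + v) • EuclideanSpace.single 0 1) W))),
             ‖h'.fieldVec (1 + n) (fun _ => ())
                 (SchwartzMap.appendTensor f₁ (translateMulti ((2 * u + v) • EuclideanSpace.single 0 1) W)) hFW‖
               ≤ C * Mg * (Mh + Mh') * (u ^ (-μ) + v ^ (-μ)) * ‖h'.fieldVec n (fun _ => ()) W hW‖)) →
      PlanarInvariant S₁ := by
  intro S₁ hOS htr hhyp h8 hC hK hreg hSig hSigT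
  have hlow := levelGrowthLow_of_kernel_pointwise hOS.2.2.2.2.1 hhyp h8 hK
  have hlg := hOS.2.2.1
  have hRP := hOS.2.2.2.1
  have hsym := hOS.2.2.2.2.1
  -- the two reconstructions
  have h : OSReconstructionNoE1 S₁.toLabelled := osReconstruction_of hRP htr
  have hT : OSReconstructionNoE1 (SchwingerFamily.toLabelled
      (fun n => (S₁ n).comp (linActMulti (planeRot (0 : Fin 3) (Real.pi / 4))))) :=
    osReconstruction_of (isReflectionPositive_pullBack h8) (translations_pullBack htr _)
  have hPSC : Summit.QuantumFields.YangMills.Theses.MirrorModularBoosts.PlanarSpectralCone :=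
    Summit.QuantumFields.YangMills.Cruxes.PlanarSpectralCone.PositivityDiscToOperatorCone.PlanarSpectralCone_of
  -- cone families
  have hN := stub_coneFamily S₁ h hlg hsym htr h8
  have hNT := stub_coneFamily (fun n => (S₁ n).comp (linActMulti (planeRot (0 : Fin 3) (Real.pi / 4)))) hT
    (hasLinearGrowth_pullBack hlg _) (isSymmetric_pullBack hsym _) (translations_pullBack htr _) (eightFrameRP_pullBack h8)
  -- the sandwich bounds (the YM input), exponents made nonnegative (`sandwich_mono_exponent`)
  obtain ⟨μ₀, Cμ, hμ₀, hS₀⟩ := hSig h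
  obtain ⟨μT₀, CμT, hST₀⟩ := hSigT hT
  have hS := sandwich_mono_exponent h hS₀
  have hST := sandwich_mono_exponent hT hST₀
  have hμ : max μ₀ 0 < 4 := max_lt hμ₀ (by norm_num)
  -- the chain, for `S₁` and for `T`
  have huni := stub_asmUniformBoost S₁ h hlg hsym htr h8 hC hN (max μ₀ 0) Cμ hS
  have hsub := stub_asmTypedBoost S₁ h hlg hsym htr h8 hC hN (max μ₀ 0) Cμ hS (le_max_right _ _)
  have huniT := stub_asmUniformBoost (fun n => (S₁ n).comp (linActMulti (planeRot (0 : Fin 3) (Real.pi / 4)))) hT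
    (hasLinearGrowth_pullBack hlg _) (isSymmetric_pullBack hsym _) (translations_pullBack htr _) (eightFrameRP_pullBack h8)
    (planarCone_pullBack hPSC hlg hsym htr h8) hNT (max μT₀ 0) CμT hST
  -- band limit and ray positivity from the local stubs
  have hband := stub_orbitBandlimitLocal S₁ hOS htr hhyp h8 hC hreg (fun _ => huni)
  have hpos := stub_rayPositivityLocal S₁ hOS htr h8 (fun _ => boostVectors_of_uniform h huni)
    (fun _ => boostVectors_of_uniform hT huniT)
  -- level growth at every level
  have hgrow : ∀ a : ℕ,
      (∀ N : ℕ, N + 2 ≤ 2 * a → ∀ R : E4 ≃ₗᵢ[ℝ] E4,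
            LinearMap.det (R.toLinearEquiv : E4 →ₗ[ℝ] E4) = 1 →
            R (EuclideanSpace.single 2 1) = EuclideanSpace.single 2 1 →
            R (EuclideanSpace.single 3 1) = EuclideanSpace.single 3 1 →
            ∀ F : SchwartzMap (Fin N → E4) ℂ, IsOffDiagonal F → S₁ N (linActMulti R F) = S₁ N F) →
      ∀ (F : 𝓢((Fin a → E4), ℂ)), IsTimeOrdered F → HasCompactSupport (F : (Fin a → E4) → ℂ) →
      ∀ H : 𝓢((Fin (a + a) → E4), ℂ), IsAppendTensorOf H (osAdjoint F) F →
      ∀ (K : ℕ) (p : ℤ → ℂ),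
        (∀ θ : ℝ, S₁ (a + a) (linActMulti (planeRot (0 : Fin 3) θ) H) =
          ∑ k ∈ Finset.Icc (-(K : ℤ)) K, p k * Complex.exp (4 * (k : ℂ) * (θ : ℂ) * Complex.I)) →
        ∀ k ∈ Finset.Icc (-(K : ℤ)) K, 2 ≤ |k| → p k = 0 := by
    intro a hInv F hF hFc H hH K p hp
    by_cases ha : a ≤ 1
    · exact hlow a ha F hF H hH K p hp
    · obtain ⟨ε, hε, V, C', hVd, hVg, hVeq⟩ := hsub a (by omega) hInv F hF hFc
      exact stub_levelGrowthHigh_of_boostType stub_laurentLayers S₁ h a F hF hFc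
        ⟨ε, hε, V, C', max μ₀ 0, hμ, hVd, hVg, hVeq⟩ H hH K p hp
  exact sieve_of_stubs S₁ hOS htr hreg hband hpos hgrow

/-- **THE CRUX FROM STEP 0 (WITH THE KERNEL ANTECEDENT) AND THE SANDWICH PAIR** (Σ for `S₁` with `μ < 4`, Σ for the `45°` pull-back
with ANY exponent).  As the landed `cruxOfInputsK` (p136406) with the weak `45°` row. -/
theorem cruxOfInputsKWeak :
    open Literature.MathematicalPhysics.QuantumLattice Literature.MathematicalPhysics.AQFT
      Literature.MathematicalPhysics.QuantumFieldTheory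
      Summit.QuantumFields.YangMills.Theorems.CurvatureBoostCovariance.Negative
      Summit.QuantumFields.YangMills.Theorems.NPointIsotropy.Negative in
    (    ∀ (G : Type) [Group G] [TopologicalSpace G] [IsTopologicalGroup G] [CompactSpace G]
       [MeasurableSpace G] [BorelSpace G], IsCompactSimpleLieGroup G →
       ∀ (r : LatticeRep G) (sch : SpeciesScheme (YMSpecies G)) (S₁ : SchwingerFamily E4),
         W1 r sch S₁ → EightFrameRP S₁ → PlanarCone S₁ →
         (∃ (K : E4 → ℝ) (C η : ℝ), 0 < η ∧ ContinuousOn K {x : E4 | x ≠ 0} ∧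
           (∀ x : E4, x ≠ 0 → |K x| ≤ C * (1 + ‖x‖ ^ (η - 10))) ∧
           ∀ F : SchwartzMap (Fin 2 → E4) ℂ, IsOffDiagonal F →
             MeasureTheory.Integrable (fun x : Fin 2 → E4 => (K (x 0 - x 1) : ℂ) * F x) ∧
               S₁ 2 F = ∫ x : Fin 2 → E4, (K (x 0 - x 1) : ℂ) * F x) →
         NPointRegular S₁) →
    (    ∀ (G : Type) [Group G] [TopologicalSpace G] [IsTopologicalGroup G] [CompactSpace G]
       [MeasurableSpace G] [BorelSpace G], IsCompactSimpleLieGroup G →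
       ∀ (r : LatticeRep G) (sch : SpeciesScheme (YMSpecies G)) (S₁ : SchwingerFamily E4),
         W1 r sch S₁ → EightFrameRP S₁ → PlanarCone S₁ →
         (∃ (K : E4 → ℝ) (C η : ℝ), 0 < η ∧ ContinuousOn K {x : E4 | x ≠ 0} ∧
           (∀ x : E4, x ≠ 0 → |K x| ≤ C * (1 + ‖x‖ ^ (η - 10))) ∧
           ∀ F : SchwartzMap (Fin 2 → E4) ℂ, IsOffDiagonal F →
             MeasureTheory.Integrable (fun x : Fin 2 → E4 => (K (x 0 - x 1) : ℂ) * F x) ∧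
               S₁ 2 F = ∫ x : Fin 2 → E4, (K (x 0 - x 1) : ℂ) * F x) →
         (∀ (h : OSReconstructionNoE1 S₁.toLabelled), ∃ μ C : ℝ, μ < 4 ∧
           (∀ (u v : ℝ), 0 < u → 0 < v → u ≤ 1 → v ≤ 1 →
              ∀ (f₁ : SchwartzMap (Fin 1 → E4) ℂ) (g hh : ℝ × ℝ → ℂ) (Mg Mh Mh' : ℝ),
                (∀ x : Fin 1 → E4, f₁ x = g (x 0 0, x 0 1) * hh (x 0 2, x 0 3)) →
                (∀ p : ℝ × ℝ, g p ≠ 0 → u ≤ p.1 ∧ p.1 ≤ 2 * u) →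
                MeasureTheory.Integrable g → (∫ p, ‖g p‖) ≤ Mg →
                MeasureTheory.Integrable hh → (∫ p, ‖hh p‖) ≤ Mh → (∀ p, ‖hh p‖ ≤ Mh') →
              ∀ (n : ℕ) (W : SchwartzMap (Fin n → E4) ℂ) (hW : IsTimeOrdered W)
                (hFW : IsTimeOrdered
                  (SchwartzMap.appendTensor f₁ (translateMulti ((2 * u + v) • EuclideanSpace.single 0 1) W))),
                ‖h.fieldVec (1 + n) (fun _ => ())
                    (SchwartzMap.appendTensor f₁ (translateMulti ((2 * u + v) • EuclideanSpace.single 0 1) W)) hFW‖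
                  ≤ C * Mg * (Mh + Mh') * (u ^ (-μ) + v ^ (-μ)) * ‖h.fieldVec n (fun _ => ()) W hW‖)) ∧
         (∀ (h' : OSReconstructionNoE1 (SchwingerFamily.toLabelled
             (fun n => (S₁ n).comp (linActMulti (planeRot (0 : Fin 3) (Real.pi / 4)))))),
           ∃ μ C : ℝ,
           (∀ (u v : ℝ), 0 < u → 0 < v → u ≤ 1 → v ≤ 1 →
              ∀ (f₁ : SchwartzMap (Fin 1 → E4) ℂ) (g hh : ℝ × ℝ → ℂ) (Mg Mh Mh' : ℝ),
                (∀ x : Fin 1 → E4, f₁ x = g (x 0 0, x 0 1) * hh (x 0 2, x 0 3)) →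
                (∀ p : ℝ × ℝ, g p ≠ 0 → u ≤ p.1 ∧ p.1 ≤ 2 * u) →
                MeasureTheory.Integrable g → (∫ p, ‖g p‖) ≤ Mg →
                MeasureTheory.Integrable hh → (∫ p, ‖hh p‖) ≤ Mh → (∀ p, ‖hh p‖ ≤ Mh') →
              ∀ (n : ℕ) (W : SchwartzMap (Fin n → E4) ℂ) (hW : IsTimeOrdered W)
                (hFW : IsTimeOrdered
                  (SchwartzMap.appendTensor f₁ (translateMulti ((2 * u + v) • EuclideanSpace.single 0 1) W))),
                ‖h'.fieldVec (1 + n) (fun _ => ())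
                    (SchwartzMap.appendTensor f₁ (translateMulti ((2 * u + v) • EuclideanSpace.single 0 1) W)) hFW‖
                  ≤ C * Mg * (Mh + Mh') * (u ^ (-μ) + v ^ (-μ)) * ‖h'.fieldVec n (fun _ => ()) W hW‖))) →
    Summit.QuantumFields.YangMills.Theses.MirrorModularBoosts.SoftKernelBoostCovariance := by
  intro h0 hSig0
  rw [Summit.QuantumFields.YangMills.Theorems.SoftKernelBoostCovariance.Negative.softKernelBoostCovariance_iff]
  intro G _ _ _ _ hG
  letI : MeasurableSpace G := borel G
  haveI : BorelSpace G := ⟨rfl⟩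
  intro r sch S₁ hW h8 hC hK
  obtain ⟨_, hOS, htr, hhyp, -⟩ := id hW
  obtain ⟨hSig, hSigT⟩ := hSig0 G hG r sch S₁ hW h8 hC hK
  exact stub_planarInvariantOfInputsWeak S₁ hOS htr hhyp h8 hC hK (h0 G hG r sch S₁ hW h8 hC hK) hSig hSigT

/-- **The item Σ implies the sandwich pair**: `CurvatureSandwichBound` (stmt-QuantumFields-18372; `45°` frame by coordinates, turned into
`planeRot (0 : Fin 3) (π/4)` by the landed `sandwichBound_planeRot_of_curvatureSandwichBound`, p138806) gives Σ_e₀ with `μ < 4` verbatim and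
Σ_45° after forgetting its `μ < 4`. -/
theorem sandwichPair_of_curvatureSandwichBound
    (hSig : Summit.QuantumFields.YangMills.Theses.IsotropyFromPowerCounting.CurvatureSandwichBound) :
    open Literature.MathematicalPhysics.QuantumLattice Literature.MathematicalPhysics.AQFT
      Literature.MathematicalPhysics.QuantumFieldTheory
      Summit.QuantumFields.YangMills.Theorems.CurvatureBoostCovariance.Negative
      Summit.QuantumFields.YangMills.Theorems.NPointIsotropy.Negative in
    (    ∀ (G : Type) [Group G] [TopologicalSpace G] [IsTopologicalGroup G] [CompactSpace G]
       [MeasurableSpace G] [BorelSpace G], IsCompactSimpleLieGroup G →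
       ∀ (r : LatticeRep G) (sch : SpeciesScheme (YMSpecies G)) (S₁ : SchwingerFamily E4),
         W1 r sch S₁ → EightFrameRP S₁ → PlanarCone S₁ →
         (∃ (K : E4 → ℝ) (C η : ℝ), 0 < η ∧ ContinuousOn K {x : E4 | x ≠ 0} ∧
           (∀ x : E4, x ≠ 0 → |K x| ≤ C * (1 + ‖x‖ ^ (η - 10))) ∧
           ∀ F : SchwartzMap (Fin 2 → E4) ℂ, IsOffDiagonal F →
             MeasureTheory.Integrable (fun x : Fin 2 → E4 => (K (x 0 - x 1) : ℂ) * F x) ∧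
               S₁ 2 F = ∫ x : Fin 2 → E4, (K (x 0 - x 1) : ℂ) * F x) →
         (∀ (h : OSReconstructionNoE1 S₁.toLabelled), ∃ μ C : ℝ, μ < 4 ∧
           (∀ (u v : ℝ), 0 < u → 0 < v → u ≤ 1 → v ≤ 1 →
              ∀ (f₁ : SchwartzMap (Fin 1 → E4) ℂ) (g hh : ℝ × ℝ → ℂ) (Mg Mh Mh' : ℝ),
                (∀ x : Fin 1 → E4, f₁ x = g (x 0 0, x 0 1) * hh (x 0 2, x 0 3)) →
                (∀ p : ℝ × ℝ, g p ≠ 0 → u ≤ p.1 ∧ p.1 ≤ 2 * u) →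
                MeasureTheory.Integrable g → (∫ p, ‖g p‖) ≤ Mg →
                MeasureTheory.Integrable hh → (∫ p, ‖hh p‖) ≤ Mh → (∀ p, ‖hh p‖ ≤ Mh') →
              ∀ (n : ℕ) (W : SchwartzMap (Fin n → E4) ℂ) (hW : IsTimeOrdered W)
                (hFW : IsTimeOrdered
                  (SchwartzMap.appendTensor f₁ (translateMulti ((2 * u + v) • EuclideanSpace.single 0 1) W))),
                ‖h.fieldVec (1 + n) (fun _ => ())
                    (SchwartzMap.appendTensor f₁ (translateMulti ((2 * u + v) • EuclideanSpace.single 0 1) W)) hFW‖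
                  ≤ C * Mg * (Mh + Mh') * (u ^ (-μ) + v ^ (-μ)) * ‖h.fieldVec n (fun _ => ()) W hW‖)) ∧
         (∀ (h' : OSReconstructionNoE1 (SchwingerFamily.toLabelled
             (fun n => (S₁ n).comp (linActMulti (planeRot (0 : Fin 3) (Real.pi / 4)))))),
           ∃ μ C : ℝ,
           (∀ (u v : ℝ), 0 < u → 0 < v → u ≤ 1 → v ≤ 1 →
              ∀ (f₁ : SchwartzMap (Fin 1 → E4) ℂ) (g hh : ℝ × ℝ → ℂ) (Mg Mh Mh' : ℝ),
                (∀ x : Fin 1 → E4, f₁ x = g (x 0 0, x 0 1) * hh (x 0 2, x 0 3)) →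
                (∀ p : ℝ × ℝ, g p ≠ 0 → u ≤ p.1 ∧ p.1 ≤ 2 * u) →
                MeasureTheory.Integrable g → (∫ p, ‖g p‖) ≤ Mg →
                MeasureTheory.Integrable hh → (∫ p, ‖hh p‖) ≤ Mh → (∀ p, ‖hh p‖ ≤ Mh') →
              ∀ (n : ℕ) (W : SchwartzMap (Fin n → E4) ℂ) (hW : IsTimeOrdered W)
                (hFW : IsTimeOrdered
                  (SchwartzMap.appendTensor f₁ (translateMulti ((2 * u + v) • EuclideanSpace.single 0 1) W))),
                ‖h'.fieldVec (1 + n) (fun _ => ())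
                    (SchwartzMap.appendTensor f₁ (translateMulti ((2 * u + v) • EuclideanSpace.single 0 1) W)) hFW‖
                  ≤ C * Mg * (Mh + Mh') * (u ^ (-μ) + v ^ (-μ)) * ‖h'.fieldVec n (fun _ => ()) W hW‖))) := by
  intro G _ _ _ _ _ _ hG r sch S₁ hW h8 hC hK
  obtain ⟨h0, h45⟩ := sandwichBound_planeRot_of_curvatureSandwichBound hSig G hG r sch S₁ hW h8 hC hK
  exact ⟨h0, fun h' => let ⟨μ, C, _, hC'⟩ := h45 h'; ⟨μ, C, hC'⟩⟩

end Summit.QuantumFields.YangMills.Theorems.SoftKernelBoostCovariance.Sketch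

end
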